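import Mathlib

/-!
# `Balaban1983to89.B16Eq155` — (1.55) of T. Bałaban, *Large field renormalization. II. Localization, exponentiation,
and bounds for the 𝐑 operation*, Commun. Math. Phys. **122**, 355–392 (1989) [Balaban1989LargeFieldII], p. 371: the
localization of the composition `G″_k J_{1,2}` — TYPED over real inner-product spaces of fields and PROVED, together with
the three unnumbered displays of pp. 370–371 that derive it

statement-level skeleton of published theorems with citation tags; proofs where landed; nothing here is a claim about
the Yang–Mills mass gap

PDF held: `paper:balaban1989-cmp122-large-field-ii` (journal page = PDF page + 354).  Every quotation below was READ AS
AN IMAGE on the x4 renders `run/shared/lean/pub/pub-balaban/b2b-balaban-ref1/pages/1989-cmp122-large-field-II/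
…-p016-x4.png`, `…-p017-x4.png` (pp. 370, 371) by this seat.

CITATION HEADER / WHAT IS REPRODUCED (mega-formalization `lit-balaban`, reader/typer r13 gen 3; HOME
`run/shared/lean/pub/lit-balaban/`, row file `lit-balaban-r13/ROWS-B16.md`): SKELETON row **B16.Eq1.55** (`absent` at
SKELETON v3.12; NE-cited locus F-T4-224) and the derivation printed before it, p. 370 l. −3 – p. 371 l. 14, verbatim:

*"The field J_{1,2} restricted to Ω″˜_{h+1} is equal to J₁, and it satisfies the criticality condition ⟨δA, J₁⟩ = 0
for δA such, that Q_{𝔅₁}δA = 0. This condition for δA, and the condition for G″_k coincide on the domain Ω″˜_{h+1},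
except the boundary layer of the width 2M₁. We use this fact to localize the considered expression. We introduce a
function θ ∈ C₀^∞((Ω″_{h+1})ᶜ), such that θ = 1 on the union of (Ω″˜_{h+1})ᶜ and the above boundary layer, and changes
from 1 to 0 near the boundary of this layer. We write G″_kJ_{1,2} = G″_k(1 − θ)J₁ + G″_kθJ_{1,2}, and the second term of
the sum is localized properly. For the first term the kernel of G″_k(1 − θ) does not satisfy the condition for averages
on the domain where the function 1 − θ is neither equal to 1, nor to 0. We improve this writing
G″_k(1 − θ) = G″_k(1 − θ)(1 − Q*_{𝔅₁}H*_{𝔅₁}) + G″_k(1 − θ)Q*_{𝔅₁}H*_{𝔅₁}.  Of course, we have the equality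
G″_k(1 − θ)(1 − Q*_{𝔅₁}H*_{𝔅₁})Q*_{𝔅₁} = 0, hence the above condition for J₁ implies
G″_k(1 − θ)(1 − Q*_{𝔅₁}H*_{𝔅₁})J₁ = 0.  Thus we have
G″_kJ_{1,2} = G″_k(1 − θ)Q*_{𝔅₁}θ₁H*_{𝔅₁}J₁ + G″_kθJ_{1,2},   (1.55)
where the function θ₁ is equal to 1 on the domain where θ ≠ 0, 1, and changes from 1 to 0 on a neighborhood of this
domain."*

CARRIERS (ref-1 F6; no new structure).  `F` = the real inner-product space of (𝔤-valued) vector fields on `T_η`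
(currents `J₁`, `J_{1,2}`, variations `δA`; inner product `⟨·,·⟩` of the display), `D` = the real inner-product space of
fields on the determining set `𝔅₁` of (1.52); `Q : F →ₗ D` = `Q_{𝔅₁}` (the averaging (2.11) [III] linearised),
`H : D →ₗ F` = `H_{𝔅₁}` (the linear minimizer operator of [15] with `Q_{𝔅₁}H_{𝔅₁} = 1`, hypothesis `hQH`),
`Qst`, `Hst` = the printed adjoints `Q*_{𝔅₁}`, `H*_{𝔅₁}` (adjointness = hypotheses `hQst`, `hHst`), `G : F →ₗ F` =
`G″_k`, `θ : F →ₗ F` and `θ₁ : D →ₗ D` = multiplication by the cut-off functions `θ` (on fields over `T_η`) and `θ₁`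
(on fields over `𝔅₁`, where `H*_{𝔅₁}J₁` lives).  READING of the two located sentences
that the print uses without display (typed as hypotheses, each quoted at its binder): (a) *"J_{1,2} restricted to
Ω″˜_{h+1} is equal to J₁"* with supp(1 − θ) ⊂ Ω″˜_{h+1} ⇒ `(1 − θ)J_{1,2} = (1 − θ)J₁` (`hJ`); (b) the insertion of
`θ₁` — *"This condition for δA, and the condition for G″_k coincide on the domain Ω″˜_{h+1}, except the boundary
layer"* (the condition for `G″_k` being `G″_kQ*_{𝔅″_k} = 0`, (3.148)–(3.153) [13]) with *"θ₁ = 1 on the domain where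
θ ≠ 0, 1"* ⇒ the operator identity `G″_k(1 − θ)Q*_{𝔅₁}(1 − θ₁) = 0` (hypothesis `hθ₁`), which `theta1_insertion_of_split`
derives from the support splitting the sentence describes (every datum off the transition layer is an interior part
killed by `θQ*` and by `G″_kQ*`, plus an exterior part killed by `(1 − θ)Q*`).  [13] = [Balaban1985BackgroundPropagators],
[15] = [Balaban1985Variational], [III] = [Balaban1988Convergent].  Nothing printed is asserted as a fact: every
declaration is a theorem proved from its displayed hypotheses; the file declares no `def` at all.
-/

namespace Literature.MathematicalPhysics.QuantumFieldTheory.Balaban1983to89.B16Eq155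

open scoped RealInnerProductSpace

variable {F D : Type*} [NormedAddCommGroup F] [InnerProductSpace ℝ F] [NormedAddCommGroup D] [InnerProductSpace ℝ D]

/-! `1` of the printed `1 − θ`, `1 − Q*_{𝔅₁}H*_{𝔅₁}` is `(LinearMap.id : F →ₗ[ℝ] F)`; the `1` of `1 − θ₁` and of
`H*_{𝔅₁}Q*_{𝔅₁} = 1` is `(LinearMap.id : D →ₗ[ℝ] D)`. -/

/-! ## The adjoint calculus of `Q_{𝔅₁}`, `H_{𝔅₁}` (p. 371: `Q*_{𝔅₁}`, `H*_{𝔅₁}`, `Q_{𝔅₁}H_{𝔅₁} = 1`) -/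

/-- `Q_{𝔅₁}H_{𝔅₁} = 1` transposes to `H*_{𝔅₁}Q*_{𝔅₁} = 1` — the fact behind the printed *"Of course, we have the
equality G″_k(1 − θ)(1 − Q*_{𝔅₁}H*_{𝔅₁})Q*_{𝔅₁} = 0"* (p. 371). [cite: Balaban1989LargeFieldII, (1.55) p.371] -/
theorem hst_comp_qst_eq_id {Q : F →ₗ[ℝ] D} {H : D →ₗ[ℝ] F} {Qst : D →ₗ[ℝ] F} {Hst : F →ₗ[ℝ] D}
    (hQst : ∀ (b : D) (a : F), ⟪Qst b, a⟫ = ⟪b, Q a⟫) (hHst : ∀ (a : F) (b : D), ⟪Hst a, b⟫ = ⟪a, H b⟫)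
    (hQH : Q ∘ₗ H = (LinearMap.id : D →ₗ[ℝ] D)) : Hst ∘ₗ Qst = (LinearMap.id : D →ₗ[ℝ] D) := by
  refine LinearMap.ext fun b => ?_
  refine ext_inner_right ℝ fun b' => ?_
  have h := congrArg (fun f : D →ₗ[ℝ] D => f b') hQH
  simp only [LinearMap.coe_comp, Function.comp_apply, LinearMap.id_coe, id_eq] at h ⊢
  rw [hHst, hQst, h]

/-- p. 371, second unnumbered display, verbatim: *"Of course, we have the equality
G″_k(1 − θ)(1 − Q*_{𝔅₁}H*_{𝔅₁})Q*_{𝔅₁} = 0"* — in fact already `(1 − Q*_{𝔅₁}H*_{𝔅₁})Q*_{𝔅₁} = 0`, from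
`Q_{𝔅₁}H_{𝔅₁} = 1`. [cite: Balaban1989LargeFieldII, (1.55) p.371] -/
theorem one_sub_qstHst_comp_qst {Q : F →ₗ[ℝ] D} {H : D →ₗ[ℝ] F} {Qst : D →ₗ[ℝ] F} {Hst : F →ₗ[ℝ] D}
    (hQst : ∀ (b : D) (a : F), ⟪Qst b, a⟫ = ⟪b, Q a⟫) (hHst : ∀ (a : F) (b : D), ⟪Hst a, b⟫ = ⟪a, H b⟫)
    (hQH : Q ∘ₗ H = (LinearMap.id : D →ₗ[ℝ] D)) :
    ((LinearMap.id : F →ₗ[ℝ] F) - Qst ∘ₗ Hst) ∘ₗ Qst = 0 := by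
  have h := hst_comp_qst_eq_id hQst hHst hQH
  refine LinearMap.ext fun b => ?_
  have hb := congrArg (fun f : D →ₗ[ℝ] D => f b) h
  simp only [LinearMap.coe_comp, Function.comp_apply, LinearMap.id_coe, id_eq] at hb
  simp only [LinearMap.coe_comp, Function.comp_apply, LinearMap.sub_apply, LinearMap.id_coe, id_eq, hb, sub_self,
    LinearMap.zero_apply]

/-- The displayed form with the prefactor `G″_k(1 − θ)`: *"G″_k(1 − θ)(1 − Q*_{𝔅₁}H*_{𝔅₁})Q*_{𝔅₁} = 0"* (p. 371).
[cite: Balaban1989LargeFieldII, (1.55) p.371] -/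
theorem G_one_sub_theta_one_sub_qstHst_comp_qst {Q : F →ₗ[ℝ] D} {H : D →ₗ[ℝ] F} {Qst : D →ₗ[ℝ] F}
    {Hst : F →ₗ[ℝ] D} (G θ : F →ₗ[ℝ] F)
    (hQst : ∀ (b : D) (a : F), ⟪Qst b, a⟫ = ⟪b, Q a⟫) (hHst : ∀ (a : F) (b : D), ⟪Hst a, b⟫ = ⟪a, H b⟫)
    (hQH : Q ∘ₗ H = (LinearMap.id : D →ₗ[ℝ] D)) :
    G ∘ₗ ((LinearMap.id : F →ₗ[ℝ] F) - θ) ∘ₗ ((LinearMap.id : F →ₗ[ℝ] F) - Qst ∘ₗ Hst) ∘ₗ Qst = 0 := by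
  rw [one_sub_qstHst_comp_qst hQst hHst hQH, LinearMap.comp_zero, LinearMap.comp_zero]

/-- p. 371, first unnumbered display, verbatim: *"We improve this writing
G″_k(1 − θ) = G″_k(1 − θ)(1 − Q*_{𝔅₁}H*_{𝔅₁}) + G″_k(1 − θ)Q*_{𝔅₁}H*_{𝔅₁}."* (an algebraic identity, no hypothesis).
[cite: Balaban1989LargeFieldII, (1.55) p.371] -/
theorem G_one_sub_theta_split (G θ : F →ₗ[ℝ] F) (Qst : D →ₗ[ℝ] F) (Hst : F →ₗ[ℝ] D) :
    G ∘ₗ ((LinearMap.id : F →ₗ[ℝ] F) - θ) = G ∘ₗ ((LinearMap.id : F →ₗ[ℝ] F) - θ) ∘ₗ ((LinearMap.id : F →ₗ[ℝ] F) - Qst ∘ₗ Hst) + G ∘ₗ ((LinearMap.id : F →ₗ[ℝ] F) - θ) ∘ₗ (Qst ∘ₗ Hst) := by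
  rw [← LinearMap.comp_add, ← LinearMap.comp_add, sub_add_cancel, LinearMap.comp_id]

/-- The criticality condition of p. 370, verbatim: *"it satisfies the criticality condition ⟨δA, J₁⟩ = 0 for δA such,
that Q_{𝔅₁}δA = 0"*, implies `J₁ = Q*_{𝔅₁}H*_{𝔅₁}J₁`: for every `w`, `⟨w, Q*H*J₁⟩ = ⟨HQw, J₁⟩` and `w − HQw` is an
admissible `δA` (`Q(w − HQw) = 0` by `QH = 1`) — the content of the third unnumbered display *"hence the above
condition for J₁ implies G″_k(1 − θ)(1 − Q*_{𝔅₁}H*_{𝔅₁})J₁ = 0"* (p. 371). [cite: Balaban1989LargeFieldII, (1.55) p.371] -/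
theorem J1_eq_qstHst_J1_of_critical {Q : F →ₗ[ℝ] D} {H : D →ₗ[ℝ] F} {Qst : D →ₗ[ℝ] F}
    {Hst : F →ₗ[ℝ] D} (hQst : ∀ (b : D) (a : F), ⟪Qst b, a⟫ = ⟪b, Q a⟫)
    (hHst : ∀ (a : F) (b : D), ⟪Hst a, b⟫ = ⟪a, H b⟫) (hQH : Q ∘ₗ H = (LinearMap.id : D →ₗ[ℝ] D)) {J₁ : F}
    (hcrit : ∀ δA : F, Q δA = 0 → ⟪δA, J₁⟫ = 0) :
    J₁ = Qst (Hst J₁) := by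
  refine ext_inner_left ℝ fun w => ?_
  have hker : Q (w - H (Q w)) = 0 := by
    have h := congrArg (fun f : D →ₗ[ℝ] D => f (Q w)) hQH
    simp only [LinearMap.coe_comp, Function.comp_apply, LinearMap.id_coe, id_eq] at h
    rw [map_sub, h, sub_self]
  have h0 := hcrit _ hker
  rw [inner_sub_left, sub_eq_zero] at h0
  rw [h0, ← real_inner_comm w, hQst, hHst]
  exact (real_inner_comm _ _).symm

/-- p. 371, third unnumbered display, verbatim: *"hence the above condition for J₁ implies
G″_k(1 − θ)(1 − Q*_{𝔅₁}H*_{𝔅₁})J₁ = 0."* [cite: Balaban1989LargeFieldII, (1.55) p.371] -/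
theorem G_one_sub_theta_one_sub_qstHst_apply_J1 {Q : F →ₗ[ℝ] D} {H : D →ₗ[ℝ] F} {Qst : D →ₗ[ℝ] F}
    {Hst : F →ₗ[ℝ] D} (G θ : F →ₗ[ℝ] F) (hQst : ∀ (b : D) (a : F), ⟪Qst b, a⟫ = ⟪b, Q a⟫)
    (hHst : ∀ (a : F) (b : D), ⟪Hst a, b⟫ = ⟪a, H b⟫) (hQH : Q ∘ₗ H = (LinearMap.id : D →ₗ[ℝ] D)) {J₁ : F}
    (hcrit : ∀ δA : F, Q δA = 0 → ⟪δA, J₁⟫ = 0) :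
    (G ∘ₗ ((LinearMap.id : F →ₗ[ℝ] F) - θ) ∘ₗ ((LinearMap.id : F →ₗ[ℝ] F) - Qst ∘ₗ Hst)) J₁ = 0 := by
  have hJ1 := J1_eq_qstHst_J1_of_critical hQst hHst hQH hcrit
  simp only [LinearMap.coe_comp, Function.comp_apply, LinearMap.sub_apply, LinearMap.id_coe, id_eq]
  rw [← hJ1, sub_self, map_zero, sub_zero, map_zero]

/-! ## The insertion of `θ₁` -/

/-- The operator identity by which `θ₁` is inserted in (1.55), `G″_k(1 − θ)Q*_{𝔅₁}(1 − θ₁) = 0`, derived from the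
support splitting described on p. 370 l. −1 – p. 371 l. 2, verbatim: *"This condition for δA, and the condition for
G″_k coincide on the domain Ω″˜_{h+1}, except the boundary layer of the width 2M₁"*, and p. 371, verbatim: *"the
function θ₁ is equal to 1 on the domain where θ ≠ 0, 1, and changes from 1 to 0 on a neighborhood of this domain"*:
if every datum `(1 − θ₁)μ` (it lives off the transition layer of `θ`) splits as `μ₀ + μ₁` with `θ(Q*μ₀) = 0` and
`G″_k(Q*μ₀) = 0` (interior part: `θ = 0` there and "the condition for `G″_k`", `G″_kQ*_{𝔅₁} = G″_kQ*_{𝔅″_k} = 0`,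
(3.148)–(3.153) [13], holds there) and `(1 − θ)(Q*μ₁) = 0` (exterior part: `θ = 1` there), then
`G″_k(1 − θ)Q*_{𝔅₁}(1 − θ₁) = 0` — the hypothesis `hθ₁` of `eq155`. [cite: Balaban1989LargeFieldII, (1.55) p.371] -/
theorem theta1_insertion_of_split (G θ : F →ₗ[ℝ] F) (θ₁ : D →ₗ[ℝ] D) (Qst : D →ₗ[ℝ] F)
    (hsplit : ∀ μ : D, ∃ μ₀ μ₁ : D, μ - θ₁ μ = μ₀ + μ₁ ∧ θ (Qst μ₀) = 0 ∧ G (Qst μ₀) = 0 ∧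
      Qst μ₁ - θ (Qst μ₁) = 0) :
    G ∘ₗ ((LinearMap.id : F →ₗ[ℝ] F) - θ) ∘ₗ Qst ∘ₗ ((LinearMap.id : D →ₗ[ℝ] D) - θ₁) = 0 := by
  refine LinearMap.ext fun μ => ?_
  obtain ⟨μ₀, μ₁, hμ, hθ0, hG0, hθ1⟩ := hsplit μ
  simp only [LinearMap.coe_comp, Function.comp_apply, LinearMap.sub_apply, LinearMap.id_coe, id_eq,
    LinearMap.zero_apply]
  rw [hμ, map_add, map_add, add_sub_add_comm, hθ1, add_zero, hθ0, sub_zero, hG0]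

/-! ## (1.55) -/

/-- **(1.55)** p. 371 [PDF 17], verbatim: *"Thus we have G″_kJ_{1,2} = G″_k(1 − θ)Q*_{𝔅₁}θ₁H*_{𝔅₁}J₁ + G″_kθJ_{1,2},
(1.55) where the function θ₁ is equal to 1 on the domain where θ ≠ 0, 1, and changes from 1 to 0 on a neighborhood of
this domain. The expression on the right-hand side above has a good localization property, which yields the required
exponential factors."*  PROVED from the printed inputs: the adjoints `Q*_{𝔅₁}`, `H*_{𝔅₁}` (`hQst`, `hHst`),
`Q_{𝔅₁}H_{𝔅₁} = 1` (`hQH`), the criticality of `J₁` (`hcrit`, p. 370), *"J_{1,2} restricted to Ω″˜_{h+1} is equal to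
J₁"* with `supp(1 − θ) ⊂ Ω″˜_{h+1}`, i.e. `(1 − θ)J_{1,2} = (1 − θ)J₁` (`hJ`), and the `θ₁`-insertion identity
`G″_k(1 − θ)Q*_{𝔅₁}(1 − θ₁) = 0` (`hθ₁`, see `theta1_insertion_of_split`). [cite: Balaban1989LargeFieldII, (1.55) p.371] -/
theorem eq155 {Q : F →ₗ[ℝ] D} {H : D →ₗ[ℝ] F} {Qst : D →ₗ[ℝ] F} {Hst : F →ₗ[ℝ] D} {G θ : F →ₗ[ℝ] F}
    {θ₁ : D →ₗ[ℝ] D} (hQst : ∀ (b : D) (a : F), ⟪Qst b, a⟫ = ⟪b, Q a⟫)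
    (hHst : ∀ (a : F) (b : D), ⟪Hst a, b⟫ = ⟪a, H b⟫) (hQH : Q ∘ₗ H = (LinearMap.id : D →ₗ[ℝ] D)) {J₁ J₁₂ : F}
    (hcrit : ∀ δA : F, Q δA = 0 → ⟪δA, J₁⟫ = 0) (hJ : J₁₂ - θ J₁₂ = J₁ - θ J₁)
    (hθ₁ : G ∘ₗ ((LinearMap.id : F →ₗ[ℝ] F) - θ) ∘ₗ Qst ∘ₗ ((LinearMap.id : D →ₗ[ℝ] D) - θ₁) = 0) :
    G J₁₂ = G (Qst (θ₁ (Hst J₁)) - θ (Qst (θ₁ (Hst J₁)))) + G (θ J₁₂) := by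
  -- `G″J_{1,2} = G″(1 − θ)J₁ + G″θJ_{1,2}`
  have hdec : G J₁₂ = G (J₁ - θ J₁) + G (θ J₁₂) := by rw [← hJ, ← map_add, sub_add_cancel]
  -- `J₁ = Q*H*J₁` (criticality and `QH = 1`)
  have hJ1 : J₁ = Qst (Hst J₁) := J1_eq_qstHst_J1_of_critical hQst hHst hQH hcrit
  -- `G″(1 − θ)Q*(1 − θ₁)(H*J₁) = 0`
  have hins : G (Qst (Hst J₁ - θ₁ (Hst J₁)) - θ (Qst (Hst J₁ - θ₁ (Hst J₁)))) = 0 := by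
    have h := congrArg (fun f : D →ₗ[ℝ] F => f (Hst J₁)) hθ₁
    simpa only [LinearMap.coe_comp, Function.comp_apply, LinearMap.sub_apply, LinearMap.id_coe, id_eq,
      LinearMap.zero_apply] using h
  rw [map_sub Qst, map_sub θ, ← hJ1] at hins
  rw [hdec]
  congr 1
  -- `G″(1 − θ)J₁ − G″(1 − θ)Q*θ₁H*J₁ = G″(1 − θ)Q*(1 − θ₁)H*J₁ = 0`
  rw [← sub_eq_zero, ← map_sub, ← hins]
  congr 1
  abel

/-- The first term of (1.55) alone: under the same hypotheses `G″_k(1 − θ)J₁ = G″_k(1 − θ)Q*_{𝔅₁}θ₁H*_{𝔅₁}J₁`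
(p. 371; the form in which the localization is used). [cite: Balaban1989LargeFieldII, (1.55) p.371] -/
theorem eq155_first_term {Q : F →ₗ[ℝ] D} {H : D →ₗ[ℝ] F} {Qst : D →ₗ[ℝ] F} {Hst : F →ₗ[ℝ] D} {G θ : F →ₗ[ℝ] F}
    {θ₁ : D →ₗ[ℝ] D} (hQst : ∀ (b : D) (a : F), ⟪Qst b, a⟫ = ⟪b, Q a⟫)
    (hHst : ∀ (a : F) (b : D), ⟪Hst a, b⟫ = ⟪a, H b⟫) (hQH : Q ∘ₗ H = (LinearMap.id : D →ₗ[ℝ] D)) {J₁ : F}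
    (hcrit : ∀ δA : F, Q δA = 0 → ⟪δA, J₁⟫ = 0)
    (hθ₁ : G ∘ₗ ((LinearMap.id : F →ₗ[ℝ] F) - θ) ∘ₗ Qst ∘ₗ ((LinearMap.id : D →ₗ[ℝ] D) - θ₁) = 0) :
    G (J₁ - θ J₁) = G (Qst (θ₁ (Hst J₁)) - θ (Qst (θ₁ (Hst J₁)))) := by
  have h := eq155 hQst hHst hQH hcrit (J₁₂ := J₁) rfl hθ₁
  have hdec : G J₁ = G (J₁ - θ J₁) + G (θ J₁) := by rw [← map_add, sub_add_cancel]
  rw [hdec] at h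
  exact add_right_cancel h

end Literature.MathematicalPhysics.QuantumFieldTheory.Balaban1983to89.B16Eq155
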